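import Summits.CriticalPhenomena.PercolationContinuityZ3.Theorems.PercExchangeRateTransportTransportLemmaFence

/-!
# One-sided transport for the crux `SubcritExchangeUniformity` (K⁻, stmt-CriticalPhenomena-16062), line `onesided`:
# one-sided LEVEL TRANSPORT above the curve (`levelTransportMono`)

Forward Euler polygon of slope `−(a(vertex)+η)` above the threshold curve with free DOWNWARD restarts
(`min` with `pc s + ε`), gap recursion `D_{k+1} ≥ (1 − L⁺h)D_k − 2ηh` from the Lipschitz clause and the forward
upper fence, hence `Θ∞(pc t₁,t₁) ≤ Θ∞(pc t₀+ε,t₀)`. Percolation-free real analysis (Mathlib + the landed fence engine).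
Helper stub `levelTransportMono` registered on stmt-CriticalPhenomena-16062 (lead c1).
-/

namespace Summit.CriticalPhenomena.PercolationContinuityZ3.Theorems.SubcritExchangeUniformity.TransportMono

open Filter Topology Set
open Summit.CriticalPhenomena.PercolationContinuityZ3.Theorems.TransportLemma
  (fence_antitoneOn fence_monotoneOn hasDerivWithinAt_along pc_modulus rightContinuity)

/-! ## Scalar inequalities for the Euler polygon -/

/-- The elementary inequality `e^{-2x} ≤ 1 - x` for `0 ≤ x ≤ 1/2`
(from `1 + 2x ≤ e^{2x}` and `(1 - x)(1 + 2x) = 1 + x(1 - 2x) ≥ 1`). -/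
private lemma exp_bound (x : ℝ) (h0 : 0 ≤ x) (h1 : x ≤ 1 / 2) : Real.exp (-(2 * x)) ≤ 1 - x := by
  have h2 : 2 * x + 1 ≤ Real.exp (2 * x) := Real.add_one_le_exp (2 * x)
  have h3 : 0 < Real.exp (2 * x) := Real.exp_pos _
  rw [Real.exp_neg, ← one_div, div_le_iff₀ h3]
  nlinarith [mul_le_mul_of_nonneg_left h2 (by linarith : (0 : ℝ) ≤ 1 - x),
    mul_nonneg h0 (by linarith : (0 : ℝ) ≤ 1 - 2 * x)]

/-- The floor recursion `d_{k+1} ≤ d_k (1 - L⁺h) - 2ηh` for the floor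
`d(x) = ε e^{-2L⁺x} - 2ηx` at `x = kh`, valid when `L⁺h ≤ 1/2`. -/
private lemma floor_step (ε Lp η h x : ℝ) (hε : 0 ≤ ε) (hLp : 0 ≤ Lp) (hη : 0 ≤ η) (hh : 0 ≤ h)
    (hx : 0 ≤ x) (hLph : Lp * h ≤ 1 / 2) :
    ε * Real.exp (-(2 * Lp * (x + h))) - 2 * η * (x + h)
      ≤ (ε * Real.exp (-(2 * Lp * x)) - 2 * η * x) * (1 - Lp * h) - 2 * η * h := by
  have h1 : Real.exp (-(2 * (Lp * h))) ≤ 1 - Lp * h := exp_bound (Lp * h) (by positivity) hLph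
  have h2 : Real.exp (-(2 * Lp * (x + h)))
      = Real.exp (-(2 * Lp * x)) * Real.exp (-(2 * (Lp * h))) := by
    rw [← Real.exp_add]; congr 1; ring
  rw [h2]
  have h3 : 0 ≤ ε * Real.exp (-(2 * Lp * x)) := by positivity
  have h4 : ε * (Real.exp (-(2 * Lp * x)) * Real.exp (-(2 * (Lp * h))))
      ≤ ε * Real.exp (-(2 * Lp * x)) * (1 - Lp * h) := by
    rw [← mul_assoc]; exact mul_le_mul_of_nonneg_left h1 h3
  nlinarith [mul_nonneg (mul_nonneg hη hx) (mul_nonneg hLp hh)]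

/-- A uniform grid of mesh `h ≤ hmax` on an interval of length `T > 0`: `N` steps with `N h = T`. -/
private lemma grid_exists (T hmax : ℝ) (hT : 0 < T) (hh : 0 < hmax) :
    ∃ N : ℕ, ∃ h : ℝ, 0 < h ∧ h ≤ hmax ∧ (N : ℝ) * h = T := by
  obtain ⟨N, hN1, hN2⟩ : ∃ N : ℕ, T / hmax ≤ N ∧ 0 < (N : ℝ) :=
    ⟨⌈T / hmax⌉₊ + 1, by push_cast; linarith [Nat.le_ceil (T / hmax)], by positivity⟩
  have hN0 : (N : ℝ) ≠ 0 := ne_of_gt hN2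
  refine ⟨N, T / N, div_pos hT hN2, ?_, ?_⟩
  · rw [div_le_iff₀ hN2]
    rw [div_le_iff₀ hh] at hN1
    linarith
  · field_simp

/-- Gap along one Euler step: with `D = Q − pc σ ≥ 0`, the `L`-Lipschitz clause at time `σ` and the forward
upper fence from `σ`, the segment `r ↦ Q − (a(Q,σ)+η)(r−σ)` stays at least `D(1 − L⁺h) − 2ηh` above `pc r`
for `σ ≤ r ≤ σ + h`. -/
private lemma gap_lower (pc : ℝ → ℝ) (a : ℝ → ℝ → ℝ) (L Lp η h σ Q r : ℝ)
    (hLLp : L ≤ Lp) (hLp : 0 ≤ Lp) (hη : 0 ≤ η) (hD : 0 ≤ Q - pc σ)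
    (hLip : |a Q σ - a (pc σ) σ| ≤ L * |Q - pc σ|)
    (hfence : pc r ≤ pc σ - (a (pc σ) σ - η) * (r - σ))
    (hr1 : σ ≤ r) (hr2 : r ≤ σ + h) :
    (Q - pc σ) * (1 - Lp * h) - 2 * η * h ≤ (Q - (a Q σ + η) * (r - σ)) - pc r := by
  rw [abs_of_nonneg hD] at hLip
  have h1 : a Q σ - a (pc σ) σ ≤ Lp * (Q - pc σ) :=
    ((abs_le.1 hLip).2).trans (mul_le_mul_of_nonneg_right hLLp hD)
  have h2 : 0 ≤ r - σ := by linarith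
  have h3 : r - σ ≤ h := by linarith
  have h4 : (a Q σ - a (pc σ) σ) * (r - σ) ≤ Lp * (Q - pc σ) * (r - σ) :=
    mul_le_mul_of_nonneg_right h1 h2
  have h5 : Lp * (Q - pc σ) * (r - σ) ≤ Lp * (Q - pc σ) * h :=
    mul_le_mul_of_nonneg_left h3 (mul_nonneg hLp hD)
  have h6 : 2 * η * (r - σ) ≤ 2 * η * h := mul_le_mul_of_nonneg_left h3 (by positivity)
  linarith

/-- Size of one Euler increment: `|(a(Q,σ)+η)(r−σ)| ≤ (A+η)h` for `σ ≤ r ≤ σ+h` when `|a(Q,σ)| ≤ A`. -/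
private lemma incr_bound (aQ η A h σ r : ℝ) (hA : |aQ| ≤ A) (hη : 0 ≤ η) (hr1 : σ ≤ r)
    (hr2 : r ≤ σ + h) : |(aQ + η) * (r - σ)| ≤ (A + η) * h := by
  rw [abs_mul, abs_of_nonneg (by linarith : 0 ≤ r - σ)]
  have h1 : |aQ + η| ≤ A + η := (abs_add_le _ _).trans (by rw [abs_of_nonneg hη]; linarith)
  have hA0 : 0 ≤ A := (abs_nonneg _).trans hA
  calc |aQ + η| * (r - σ) ≤ (A + η) * (r - σ) := mul_le_mul_of_nonneg_right h1 (by linarith)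
    _ ≤ (A + η) * h := mul_le_mul_of_nonneg_left (by linarith) (by linarith)

/-! ## One Euler step through the fence lemma -/

/-- One Euler step read through the fence lemma: along the affine segment `r ↦ Q − c(r − σ)` on `[σ, σ+h]`,
which stays in the right collar and has slope defect `a − c ≤ −η/2`, a `p`-monotone `Θ` obeying the exchange
inequality with slack `η/2` on the right collar does not increase. -/
private lemma euler_step (Θ : ℝ → ℝ → ℝ) (a : ℝ → ℝ → ℝ) (pc : ℝ → ℝ) (lo hi ρ η c Q σ h : ℝ)
    (hdiff : ∀ t ∈ Set.Icc lo hi, ∀ p : ℝ, pc t ≤ p → p ≤ pc t + ρ →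
      DifferentiableAt ℝ (fun x : ℝ × ℝ => Θ x.1 x.2) (p, t))
    (hmono : ∀ t, Monotone (fun p => Θ p t))
    (hex : ∀ t ∈ Set.Icc lo hi, ∀ p : ℝ, pc t ≤ p → p ≤ pc t + ρ →
      |deriv (fun s => Θ p s) t - a p t * deriv (fun q => Θ q t) p| ≤ η / 2 * deriv (fun q => Θ q t) p)
    (hsub : Set.Icc σ (σ + h) ⊆ Set.Icc lo hi) (hh : 0 ≤ h)
    (hcol : ∀ r ∈ Set.Icc σ (σ + h), pc r ≤ Q - c * (r - σ) ∧ Q - c * (r - σ) ≤ pc r + ρ)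
    (hslope : ∀ r ∈ Set.Icc σ (σ + h), a (Q - c * (r - σ)) r - c ≤ -(η / 2)) :
    Θ (Q - c * h) (σ + h) ≤ Θ Q σ := by
  have hγd : ∀ r ∈ Set.Icc σ (σ + h),
      HasDerivWithinAt (fun r => Q - c * (r - σ)) ((fun _ => -c) r) (Set.Icc σ (σ + h)) r := by
    intro r _
    have h1 : HasDerivAt (fun r => Q - c * (r - σ)) (-(c * 1)) r :=
      (((hasDerivAt_id r).sub_const σ).const_mul c).const_sub Q
    simpa using h1.hasDerivWithinAt
  have hA : AntitoneOn (fun s => Θ (Q - c * (s - σ)) s) (Set.Icc σ (σ + h)) :=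
    fence_antitoneOn Θ a (fun r => Q - c * (r - σ)) (fun _ => -c) (η / 2) σ (σ + h)
      (fun r hr => hdiff r (hsub hr) _ (hcol r hr).1 (hcol r hr).2)
      hmono hγd
      (fun r hr => hex r (hsub hr) _ (hcol r hr).1 (hcol r hr).2)
      (fun r hr => by have := hslope r hr; show -c + a (Q - c * (r - σ)) r ≤ -(η / 2); linarith)
  have hσh : σ ≤ σ + h := by linarith
  have h1 : Θ (Q - c * ((σ + h) - σ)) (σ + h) ≤ Θ (Q - c * (σ - σ)) σ :=
    hA (Set.left_mem_Icc.2 hσh) (Set.right_mem_Icc.2 hσh) hσh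
  simpa only [add_sub_cancel_left, sub_self, mul_zero, sub_zero] using h1

/-- The inductive step of the polygon argument at a vertex `(Q, σ)` whose gap `Q − pc σ` lies in `[d_k, ε]`
(`0 < d_k`, `0 < d_{k+1} ≤ d_k(1 − L⁺h) − 2ηh`): the Euler segment of slope `−(a(Q,σ)+η)` on `[σ, σ+h]` stays in
the right collar and at least `d_{k+1}` above the curve (forward upper fence + Lipschitz clause), its slope defect
is `≤ −η/2` (uniform modulus of `a`), so every `Θ n`, `n ≥ m`, does not increase along it (fence lemma). -/
private lemma euler_vertex (Θ : ℕ → ℝ → ℝ → ℝ) (pc : ℝ → ℝ) (a : ℝ → ℝ → ℝ)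
    (lo hi ρ L Lp A ε η ω τp τU h dk dk' σ Q : ℝ) (m : ℕ)
    (hmp : ∀ n t, Monotone (fun p => Θ n p t))
    (hdiff : ∀ n, ∀ t ∈ Set.Icc lo hi, ∀ p : ℝ, pc t ≤ p → p ≤ pc t + ρ →
      DifferentiableAt ℝ (fun x : ℝ × ℝ => Θ n x.1 x.2) (p, t))
    (hA : ∀ t ∈ Set.Icc lo hi, ∀ p : ℝ, pc t ≤ p → p ≤ pc t + ρ → |a p t| ≤ A)
    (hωa : ∀ t ∈ Set.Icc lo hi, ∀ t' ∈ Set.Icc lo hi, ∀ p p' : ℝ, pc t ≤ p → p ≤ pc t + ρ →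
      pc t' ≤ p' → p' ≤ pc t' + ρ → |t - t'| ≤ ω → |p - p'| ≤ ω → |a p t - a p' t'| ≤ η / 2)
    (hpcm : ∀ t ∈ Set.Icc lo hi, ∀ t' ∈ Set.Icc lo hi, |t - t'| ≤ τp → |pc t - pc t'| ≤ ρ / 4)
    (hL : ∀ t ∈ Set.Icc lo hi, ∀ p q : ℝ, pc t ≤ p → p ≤ pc t + ρ → pc t ≤ q → q ≤ pc t + ρ →
      |a p t - a q t| ≤ L * |p - q|)
    (hm : ∀ n ≥ m, ∀ t ∈ Set.Icc lo hi, ∀ p : ℝ, pc t ≤ p → p ≤ pc t + ρ →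
      |deriv (fun s => Θ n p s) t - a p t * deriv (fun q => Θ n q t) p|
        ≤ η / 2 * deriv (fun q => Θ n q t) p)
    (hU : ∀ t₀ ∈ Set.Icc lo hi, ∀ s ∈ Set.Icc lo hi, t₀ ≤ s → s ≤ t₀ + τU →
      pc s ≤ pc t₀ - (a (pc t₀) t₀ - η) * (s - t₀))
    (hLLp : L ≤ Lp) (hLp0 : 0 ≤ Lp) (hη : 0 < η) (hh0 : 0 < h) (hερ : ε < ρ / 2)
    (hτU_h : h ≤ τU) (hτp_h : h ≤ τp) (hω_h : h ≤ ω) (hω2 : (A + η + 1) * h ≤ ω)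
    (hLph : Lp * h ≤ 1 / 2) (hρh : (A + η + 1) * h ≤ ρ / 4)
    (hsub : Set.Icc σ (σ + h) ⊆ Set.Icc lo hi)
    (hdk' : dk' ≤ dk * (1 - Lp * h) - 2 * η * h) (hdk'pos : 0 < dk') (hdkpos : 0 < dk)
    (hD1 : dk ≤ Q - pc σ) (hD2 : Q - pc σ ≤ ε) :
    dk' ≤ (Q - (a Q σ + η) * h) - pc (σ + h) ∧
      ∀ n ≥ m, Θ n (Q - (a Q σ + η) * h) (σ + h) ≤ Θ n Q σ := by
  have hσ : σ ∈ Set.Icc lo hi := hsub (Set.left_mem_Icc.2 (by linarith))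
  have hDpos : 0 < Q - pc σ := lt_of_lt_of_le hdkpos hD1
  have hQ1 : pc σ ≤ Q := by linarith only [hDpos]
  have hQ2 : Q ≤ pc σ + ρ := by linarith only [hD2, hερ, hDpos]
  have haQ : |a Q σ| ≤ A := hA σ hσ Q hQ1 hQ2
  have hLip : |a Q σ - a (pc σ) σ| ≤ L * |Q - pc σ| :=
    hL σ hσ Q (pc σ) hQ1 hQ2 le_rfl (by linarith only [hD2, hερ, hDpos])
  -- the gap along the step stays above the floor
  have hgap : ∀ r ∈ Set.Icc σ (σ + h), dk' ≤ (Q - (a Q σ + η) * (r - σ)) - pc r := by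
    intro r hr
    have hfence := hU σ hσ r (hsub hr) hr.1 (by linarith only [hr.2, hτU_h])
    have h1 := gap_lower pc a L Lp η h σ Q r hLLp hLp0 hη.le hDpos.le hLip hfence hr.1 hr.2
    have h3 : 0 ≤ 1 - Lp * h := by linarith only [hLph]
    have h2 := mul_le_mul_of_nonneg_right hD1 h3
    linarith only [h1, h2, hdk']
  have hlow : ∀ r ∈ Set.Icc σ (σ + h), pc r < Q - (a Q σ + η) * (r - σ) := fun r hr => by
    linarith only [hgap r hr, hdk'pos]
  -- ... and inside the right collar
  have hup : ∀ r ∈ Set.Icc σ (σ + h), Q - (a Q σ + η) * (r - σ) < pc r + ρ := by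
    intro r hr
    have hpcr : |pc σ - pc r| ≤ ρ / 4 :=
      hpcm σ hσ r (hsub hr) (by rw [abs_le]; constructor <;> linarith only [hr.1, hr.2, hτp_h, hh0])
    have hinc := incr_bound (a Q σ) η A h σ r haQ hη.le hr.1 hr.2
    have h3 := neg_abs_le ((a Q σ + η) * (r - σ))
    linarith only [(abs_le.1 hpcr).1, (abs_le.1 hpcr).2, hinc, h3, hρh, hh0, hD2, hερ]
  -- the slope defect along the step
  have hslope : ∀ r ∈ Set.Icc σ (σ + h),
      a (Q - (a Q σ + η) * (r - σ)) r - (a Q σ + η) ≤ -(η / 2) := by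
    intro r hr
    have hinc := incr_bound (a Q σ) η A h σ r haQ hη.le hr.1 hr.2
    have hmod := hωa r (hsub hr) σ hσ (Q - (a Q σ + η) * (r - σ)) Q
      (hlow r hr).le (hup r hr).le hQ1 hQ2
      (by rw [abs_le]; constructor <;> linarith only [hr.1, hr.2, hω_h, hh0])
      (by rw [sub_sub_cancel_left, abs_neg]; linarith only [hinc, hω2, hh0])
    linarith only [(abs_le.1 hmod).2]
  refine ⟨?_, fun n hn => ?_⟩
  · have h1 := hgap (σ + h) (Set.right_mem_Icc.2 (by linarith))
    rwa [add_sub_cancel_left] at h1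
  · exact euler_step (Θ n) a pc lo hi ρ η (a Q σ + η) Q σ h (hdiff n) (hmp n) (hm n hn) hsub hh0.le
      (fun r hr => ⟨(hlow r hr).le, (hup r hr).le⟩) hslope

/-! ## The level transport -/

/-- **One-sided level transport.** Given the right-collar data (bound `A` and uniform modulus of `a`, `L`-Lipschitz in
`p`, the exchange inequality for `n ≥ m(η)`), a uniform modulus of `pc`, and the FORWARD upper fence
`pc s ≤ pc t₀ − (a(pc t₀,t₀) − η)(s − t₀)` (`t₀ ≤ s ≤ t₀+τ(η)`), for `lo ≤ t₀ ≤ t₁ ≤ hi` and all small `ε > 0`: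
`⨅ₙ Θ n (pc t₁) t₁ ≤ ⨅ₙ Θ n (pc t₀ + ε) t₀`. -/
theorem levelTransportMono : ∀ (Θ : ℕ → ℝ → ℝ → ℝ) (pc : ℝ → ℝ) (a : ℝ → ℝ → ℝ) (lo hi ρ L A : ℝ), 0 < lo → lo < hi → hi < 1 → 0 < ρ → (∀ n, ContDiffOn ℝ 1 (fun x : ℝ × ℝ => Θ n x.1 x.2) (Set.Ioo 0 1 ×ˢ Set.Ioo 0 1)) → (∀ n t, Monotone (fun p => Θ n p t)) → (∀ p t, Antitone (fun n => Θ n p t)) → (∀ n p t, 0 ≤ Θ n p t) → (∀ t ∈ Set.Icc lo hi, ρ < pc t ∧ pc t + ρ < 1) → (∀ t ∈ Set.Icc lo hi, ∀ p : ℝ, pc t ≤ p → p ≤ pc t + ρ → |a p t| ≤ A) → (∀ η > (0 : ℝ), ∃ ω > (0 : ℝ), ∀ t ∈ Set.Icc lo hi, ∀ t' ∈ Set.Icc lo hi, ∀ p p' : ℝ, pc t ≤ p → p ≤ pc t + ρ → pc t' ≤ p' → p' ≤ pc t' + ρ → |t - t'| ≤ ω → |p - p'| ≤ ω → |a p t -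 a p' t'| ≤ η) → (∀ κ > (0 : ℝ), ∃ τ > (0 : ℝ), ∀ t ∈ Set.Icc lo hi, ∀ t' ∈ Set.Icc lo hi, |t - t'| ≤ τ → |pc t - pc t'| ≤ κ) → (∀ t ∈ Set.Icc lo hi, ∀ p q : ℝ, pc t ≤ p → p ≤ pc t + ρ → pc t ≤ q → q ≤ pc t + ρ → |a p t - a q t| ≤ L * |p - q|) → (∀ η > (0 : ℝ), ∃ m : ℕ, ∀ n ≥ m, ∀ t ∈ Set.Icc lo hi, ∀ p : ℝ, pc t ≤ p → p ≤ pc t + ρ → |deriv (fun s => Θ n p s) t - a p t * deriv (fun q => Θ n q t) p| ≤ η * deriv (fun q => Θ n q t) p) → (∀ η > (0 : ℝ), ∃ τ > (0 : ℝ), ∀ t₀ ∈ Set.Icc lo hi, ∀ s ∈ Set.Icc lo hi, t₀ ≤ s → s ≤ t₀ + τ → pc s ≤ pc t₀ - (a (pc t₀) t₀ - η) * (s - t₀)) → ∀ t₀ t₁ : ℝ, lo ≤ t₀ → t₀ ≤ t₁ → t₁ ≤ hi → ∃ ε₀ > (0 : ℝ), ∀ ε : ℝ, 0 < ε → ε <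 ε₀ → (⨅ n, Θ n (pc t₁) t₁) ≤ (⨅ n, Θ n (pc t₀ + ε) t₀) := by
  intro Θ pc a lo hi ρ L A hlo hlohi hhi hρ hC1 hmp hanti hnn hcollar hA hω hτ hL hexR hUF
    t₀ t₁ ht₀ ht₀₁ ht₁
  refine ⟨ρ / 2, by positivity, fun ε hε hερ => ?_⟩
  -- bookkeeping
  have hIcc : Set.Icc t₀ t₁ ⊆ Set.Icc lo hi := Set.Icc_subset_Icc ht₀ ht₁
  have bdd : ∀ q s, BddBelow (Set.range fun n => Θ n q s) := fun q s =>
    ⟨0, by rintro _ ⟨n, rfl⟩; exact hnn n q s⟩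
  -- the degenerate case `t₀ = t₁`
  rcases eq_or_lt_of_le ht₀₁ with heq | hlt
  · subst heq
    exact ciInf_mono (bdd _ _) fun n => hmp n t₀ (by linarith)
  -- constants (kept opaque: `T = t₁ - t₀`, `L ≤ Lp`, `E = e^{-2 Lp T}`, `η = εE/(8(T+1))`)
  obtain ⟨T, hT⟩ : ∃ T : ℝ, T = t₁ - t₀ := ⟨_, rfl⟩
  have hTpos : 0 < T := by rw [hT]; exact sub_pos.mpr hlt
  obtain ⟨Lp, hLLp, hLp0⟩ : ∃ Lp : ℝ, L ≤ Lp ∧ 0 ≤ Lp := ⟨max L 0, le_max_left _ _, le_max_right _ _⟩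
  obtain ⟨E, hE⟩ : ∃ E : ℝ, E = Real.exp (-(2 * Lp * T)) := ⟨_, rfl⟩
  have hEpos : 0 < E := by rw [hE]; exact Real.exp_pos _
  obtain ⟨η, hη⟩ : ∃ η : ℝ, η = ε * E / (8 * (T + 1)) := ⟨_, rfl⟩
  have hηpos : 0 < η := by rw [hη]; positivity
  have hT1 : (T + 1) ≠ 0 := by positivity
  have hηT : η * (T + 1) = ε * E / 8 := by
    rw [hη]; field_simp
  obtain ⟨m, hm⟩ := hexR (η / 2) (by positivity)
  obtain ⟨ω, hω0, hωa⟩ := hω (η / 2) (by positivity)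
  obtain ⟨τp, hτp0, hpcm⟩ := hτ (ρ / 4) (by positivity)
  obtain ⟨τU, hτU0, hU⟩ := hUF η hηpos
  have hA0 : 0 ≤ A := by
    have hlo' : lo ∈ Set.Icc lo hi := Set.left_mem_Icc.2 hlohi.le
    exact (abs_nonneg _).trans (hA lo hlo' (pc lo) le_rfl (by linarith only [hρ]))
  have infle : ∀ q s q' s', (∀ n ≥ m, Θ n q s ≤ Θ n q' s') →
      (⨅ n, Θ n q s) ≤ ⨅ n, Θ n q' s' := by
    intro q s q' s' h
    refine le_ciInf fun N => ?_
    calc (⨅ n, Θ n q s) ≤ Θ (max N m) q s := ciInf_le (bdd q s) _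
      _ ≤ Θ (max N m) q' s' := h _ (le_max_right _ _)
      _ ≤ Θ N q' s' := hanti q' s' (le_max_left _ _)
  have hsq : IsOpen (Set.Ioo (0:ℝ) 1 ×ˢ Set.Ioo (0:ℝ) 1) := isOpen_Ioo.prod isOpen_Ioo
  have hdiff : ∀ n, ∀ t ∈ Set.Icc lo hi, ∀ p : ℝ, pc t ≤ p → p ≤ pc t + ρ →
      DifferentiableAt ℝ (fun x : ℝ × ℝ => Θ n x.1 x.2) (p, t) := by
    intro n t ht p hp1 hp2
    obtain ⟨hc1, hc2⟩ := hcollar t ht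
    apply ((hC1 n).differentiableOn one_ne_zero).differentiableAt
    apply hsq.mem_nhds
    exact ⟨⟨by linarith only [hc1, hp1, hρ], by linarith only [hp2, hc2]⟩,
      ⟨by linarith only [ht.1, hlo], by linarith only [ht.2, hhi]⟩⟩
  -- step size
  obtain ⟨N, h, hh0, hhmax, hNh⟩ := grid_exists T
    (min τU (min τp (min ω (min (ω / (A + η + 1)) (min (1 / (2 * Lp + 1)) (ρ / (4 * (A + η + 1))))))))
    hTpos (lt_min hτU0 (lt_min hτp0 (lt_min hω0 (lt_min (by positivity)
      (lt_min (by positivity) (by positivity))))))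
  simp only [le_min_iff] at hhmax
  obtain ⟨hτU_h, hτp_h, hω_h, hω'_h, hL_h, hρ_h⟩ := hhmax
  have hω2 : (A + η + 1) * h ≤ ω := by
    rw [le_div_iff₀ (by positivity)] at hω'_h; linarith only [hω'_h]
  have hLph : Lp * h ≤ 1 / 2 := by
    rw [le_div_iff₀ (by positivity)] at hL_h; linarith only [hL_h, hh0]
  have hρh : (A + η + 1) * h ≤ ρ / 4 := by
    rw [le_div_iff₀ (by positivity)] at hρ_h; linarith only [hρ_h]
  have hkh : ∀ k : ℕ, k ≤ N → (k : ℝ) * h ≤ T := by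
    intro k hk
    have hk' : (k : ℝ) ≤ N := Nat.cast_le.mpr hk
    have := mul_le_mul_of_nonneg_right hk' hh0.le
    linarith only [this, hNh]
  -- the grid
  obtain ⟨s, hs⟩ : ∃ s : ℕ → ℝ, ∀ k, s k = t₀ + (k : ℝ) * h := ⟨fun k => t₀ + (k : ℝ) * h, fun _ => rfl⟩
  have hs0 : s 0 = t₀ := by rw [hs]; simp
  have hs_succ : ∀ k, s (k + 1) = s k + h := by intro k; rw [hs, hs]; push_cast; ring
  have hsN : s N = t₁ := by rw [hs]; linarith only [hNh, hT]
  have hs_mem : ∀ k, k ≤ N → s k ∈ Set.Icc t₀ t₁ := by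
    intro k hk
    rw [hs]
    have h1 : 0 ≤ (k : ℝ) * h := by positivity
    have h2 := hkh k hk
    exact ⟨by linarith only [h1], by linarith only [h2, hT]⟩
  -- the polygon with downward restarts
  obtain ⟨q, hq0, hq⟩ : ∃ q : ℕ → ℝ, q 0 = pc t₀ + ε ∧
      ∀ k, q (k + 1) = min (q k - (a (q k) (s k) + η) * h) (pc (s (k + 1)) + ε) :=
    ⟨fun k => Nat.rec (motive := fun _ => ℝ) (pc t₀ + ε)
      (fun j qj => min (qj - (a qj (s j) + η) * h) (pc (s (j + 1)) + ε)) k, rfl, fun _ => rfl⟩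
  -- the floor `d k = ε e^{-2 Lp k h} - 2 η k h`
  obtain ⟨d, hd⟩ : ∃ d : ℕ → ℝ, ∀ k,
      d k = ε * Real.exp (-(2 * Lp * ((k : ℝ) * h))) - 2 * η * ((k : ℝ) * h) :=
    ⟨fun k => ε * Real.exp (-(2 * Lp * ((k : ℝ) * h))) - 2 * η * ((k : ℝ) * h), fun _ => rfl⟩
  have hd0 : d 0 = ε := by rw [hd]; simp
  have hd_pos : ∀ k, k ≤ N → ε * E / 2 < d k := by
    intro k hk
    have h1 : (k : ℝ) * h ≤ T := hkh k hk
    have h2 : E ≤ Real.exp (-(2 * Lp * ((k : ℝ) * h))) := by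
      rw [hE]; exact Real.exp_le_exp.mpr (by linarith only [mul_le_mul_of_nonneg_left h1 hLp0])
    have h3 : 2 * η * ((k : ℝ) * h) ≤ 2 * η * T := mul_le_mul_of_nonneg_left h1 (by positivity)
    have h4 := mul_le_mul_of_nonneg_left h2 hε.le
    rw [hd]
    linarith only [h3, h4, hηT, mul_pos hε hEpos, hηpos]
  have hd_le : ∀ k, d k ≤ ε := by
    intro k
    rw [hd]
    have h0 : 0 ≤ Lp * ((k : ℝ) * h) := by positivity
    have h1 : Real.exp (-(2 * Lp * ((k : ℝ) * h))) ≤ 1 :=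
      Real.exp_le_one_iff.mpr (by linarith only [h0])
    have h2 : 0 ≤ 2 * η * ((k : ℝ) * h) := by positivity
    linarith only [mul_le_mul_of_nonneg_left h1 hε.le, h2]
  have hd_step : ∀ k : ℕ, d (k + 1) ≤ d k * (1 - Lp * h) - 2 * η * h := by
    intro k
    rw [hd, hd]
    have := floor_step ε Lp η h ((k : ℝ) * h) hε.le hLp0 hηpos.le hh0.le (by positivity) hLph
    have e : (((k + 1 : ℕ) : ℝ) * h) = (k : ℝ) * h + h := by push_cast; ring
    rw [e]; exact this
  -- the induction along the polygon
  have main : ∀ k, k ≤ N → d k ≤ q k - pc (s k) ∧ q k - pc (s k) ≤ ε ∧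
      ∀ n ≥ m, Θ n (q k) (s k) ≤ Θ n (pc t₀ + ε) t₀ := by
    intro k
    induction k with
    | zero =>
      intro _
      rw [hd0, hq0, hs0]
      exact ⟨le_of_eq (by ring), le_of_eq (by ring), fun n _ => le_rfl⟩
    | succ k ih =>
      intro hk1
      have hk : k ≤ N := Nat.le_of_succ_le hk1
      obtain ⟨ih1, ih2, ih3⟩ := ih hk
      have hsk1 : s (k + 1) = s k + h := hs_succ k
      have hsub : Set.Icc (s k) (s k + h) ⊆ Set.Icc lo hi := fun r hr =>
        ⟨le_trans (hIcc (hs_mem k hk)).1 hr.1, by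
          have h2 := (hIcc (hs_mem (k + 1) hk1)).2
          rw [hsk1] at h2
          exact le_trans hr.2 h2⟩
      have hdkpos : 0 < d k := lt_trans (by positivity) (hd_pos k hk)
      have hdk1pos : 0 < d (k + 1) := lt_trans (by positivity) (hd_pos (k + 1) hk1)
      obtain ⟨hgap, hstep⟩ := euler_vertex Θ pc a lo hi ρ L Lp A ε η ω τp τU h (d k) (d (k + 1))
        (s k) (q k) m hmp hdiff hA hωa hpcm hL hm hU hLLp hLp0 hηpos hh0 hερ hτU_h hτp_h hω_h hω2
        hLph hρh hsub (hd_step k) hdk1pos hdkpos ih1 ih2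
      rw [hq k, hsk1]
      refine ⟨?_, ?_, fun n hn => ?_⟩
      · have h2 := hd_le (k + 1)
        rw [le_sub_iff_add_le, le_min_iff]
        constructor <;> linarith only [hgap, h2]
      · have := min_le_right (q k - (a (q k) (s k) + η) * h) (pc (s k + h) + ε)
        linarith only [this]
      · calc Θ n (min (q k - (a (q k) (s k) + η) * h) (pc (s k + h) + ε)) (s k + h)
            ≤ Θ n (q k - (a (q k) (s k) + η) * h) (s k + h) := hmp n _ (min_le_left _ _)
          _ ≤ Θ n (q k) (s k) := hstep n hn
          _ ≤ Θ n (pc t₀ + ε) t₀ := ih3 n hn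
  -- conclusion at `k = N`, where `s N = t₁`
  obtain ⟨hN1, -, hN3⟩ := main N le_rfl
  rw [hsN] at hN1 hN3
  have hpos := hd_pos N le_rfl
  have hqN : pc t₁ ≤ q N := by
    have : 0 < ε * E / 2 := by positivity
    linarith only [hN1, hpos, this]
  exact infle _ _ _ _ (fun n hn => (hmp n t₁ hqN).trans (hN3 n hn))

end Summit.CriticalPhenomena.PercolationContinuityZ3.Theorems.SubcritExchangeUniformity.TransportMono
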